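import Summits.BirchSwinnertonDyer.BirchSwinnertonDyer.Theorems.SylvesterTwoHeegnerIndexYinLower
import HarnessLib

/-!
# Route `SylvesterTwoHeegnerIndex` (rung K7t): the UPPER crux 19725 (children 19802 / 19804) in Yin's
# SINGLE-CURVE point-divisibility currency, and the RUNG LEAF `X12.CMAtTwo` ⟺ (low) ∧ (up) —
# part II of `…YinLower` (crux decls BY NAME, both directions)

Cell `bsd-cm`, seat `bsd-cm-k7t-c2` (prover-bsd-cm-k7t-c2-g9-0). PARTITION (D-0054): CornerF at
`p = 2` (B14/O12) × 𝒞_HSY (both residue classes) × `p = 2` — types-the-object-of (kernel re-typing,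
`--supports stmt-BirchSwinnertonDyer-19804`); closes no cell and no item; BSD is not claimed.
Everything here is PROVED: no definition, no named fact, no `sorry`. The RESIDUALS (low) / (up) are the
DISPLAYED HYPOTHESES of part I (`…YinLower.lean`, module docstring), verbatim in the signatures:
(low) «granted `PublishedFactsTwo`, at every display datum `(K, P₀, Y, u)` of every member,
`Y ∈ 2^j·B(K) + tors ⟹ 2j + 2δ ≤ ord₂ #Ш(B)[2^∞]`»; (up) «granted `PublishedFactsTwoPlus`, at every
display datum, `∃ j, Y ∈ 2^j·B(K) + tors ∧ ord₂ #Ш(B)[2^∞] ≤ 2j + 2δ`» (`2δ = 0 | −2` for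
`p ≡ 4 | 7 (9)`). Nothing is asserted about them.

THEOREMS (granted Yin's display `SylvesterTwoYin.YinHeightDisplay`, PREPRINT shape):
* §2 UPPER: `forall_missingUpperBoundAt_of_yin_of_up` (per member), `upperOfFactsPlus_of_yin_of_up`
  (19725 `HeegnerIndexUpperAtTwoHSYOfFactsPlus` BY NAME), `upperOffV0HSYPlus_of_yin_of_up` (the LIVE
  child 19804 BY NAME — the DEAD line offv0-kolyvagin2's residual (OFFB) in point currency),
  `hsyPointTwoDivisibleSevenModNine_of_yin_of_up` (the LIVE child 19802 = THEOREM C BY NAME, via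
  `2`-integrality and bsd-cm-two's p464849), the converse `up_of_upperOfFactsPlus_of_yin`, and
  **`upperOfFactsPlus_iff_up_of_yin`**: modulo the display, the UPPER crux IS (up).
* §3 RUNG: **`cmAtTwo_iff_low_and_up_of_yin`** — granted `PublishedFactsTwoPlus` (19724) and the
  display, the rung leaf `X12.CMAtTwo` (`BSD(E_p, 2)` for every minimal model of every 𝒞_HSY member)
  ⟺ (low) ∧ (up): `BSD₂` on the Sylvester family is the statement that ONE explicit point per `p`
  (Yin's `Z_p`) has `2`-divisibility index EXACTLY `ord₂ #Ш(E_p)[2^∞]/2 − δ` in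
  `E_p(ℚ(√−3))/tors ≅ ℤ[ω]` — memo two Thm B (iii) in single-curve kernel form, both directions.

HONEST READING. An EQUIVALENT REFORMULATION of open statements: (up) beyond its first bit (C′) is the
Kolyvagin direction at `2` (no class-wide tool; D157), (low) the main-conjecture direction at the
inert `2` (no mechanism in print; memo two §22.3). Nothing here decides the index for any `p`.

## References
* H. Yin, arXiv:2607.01744 (2026), Thm. 1.1, (3.5.3), p. 12 (PREPRINT).
* Y. Hu, J. Shu, H. Yin, Trans. AMS 372 (2019) = arXiv:1708.05266, Thm. 1.3/1.4, (bsd) p. 12.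
* A. Burungale, M. Flach, Camb. J. Math. 12 (2024), Thm. 1.1, Cor. 2.
* V. A. Kolyvagin, Euler systems (1990), Thm. A; R. L. Miller, LMS J. Comput. Math. 14 (2011), Def. 1.1.
* MEMO bsd-cm-two v2.11 §15.2, §22, §46–§47; parents p418375, p464849, p478097, part I `…YinLower`.
-/

set_option autoImplicit false
-- the Summit-side namespace `Summit.BirchSwinnertonDyer.BirchSwinnertonDyer.…` (summit = problem) is mandated by D-0017
set_option linter.dupNamespace false

noncomputable section

open scoped Classical

open WeierstrassCurve WeierstrassCurve.Affine WeierstrassCurve.Affine.Point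
  Summit.BirchSwinnertonDyer.BirchSwinnertonDyer.Theorems.SylvesterTwoCMNormForm
  Summit.BirchSwinnertonDyer.BirchSwinnertonDyer.Theorems.SylvesterTwoNonneg
  Summit.BirchSwinnertonDyer.BirchSwinnertonDyer.Theorems.SylvesterTwoThmCAssembly
  Literature.NumberTheory.EllipticCurves Literature.NumberTheory.EllipticCurves.HuShuYin2019
  Literature.NumberTheory.EllipticCurves.Rank1Residual.Typed

namespace Summit.BirchSwinnertonDyer.BirchSwinnertonDyer.Theorems.SylvesterTwoYinLower

/-! ## §2 UPPER: items 19725 / 19804 / 19802 BY NAME from (up), and back -/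

/-- **Per member: (up) ⟹ the Euler-system half.** Granted Yin's display, (up) and
`PublishedFactsTwoPlus`: `MissingUpperBoundAt B 2` for every minimal model of every 𝒞_HSY member
(`missingUpperBoundAt_two_iff_exists_powDivisible_ge` at `K = ℚ(ζ₃)`, with §0).
[cite: Miller2011LMS, §1 and Def. 1.1] [cite: HuShuYin2019, Thm. 1.3 / 1.4, pp. 8, 12] -/
theorem forall_missingUpperBoundAt_of_yin_of_up (hY : SylvesterTwoYin.YinHeightDisplay)
    (hup : Theses.SylvesterTwoHeegnerIndex.PublishedFactsTwoPlus →
      ∀ (p : ℕ), p.Prime → (p % 9 = 4 ∨ p % 9 = 7) → (¬ ∃ x : ZMod p, x ^ 3 = 3) →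
      ∀ (B : WeierstrassCurve ℚ) [B.IsElliptic] [B.IsGloballyMinimal],
        (∃ C : VariableChange ℚ, C • B = cubeSumCurve (p : ℚ)) → ∀ (qB : ℚ), shaAn B = (qB : ℂ) →
      ∀ (K : Type) [Field K] [NumberField K] (ω : K), ω ^ 2 + ω + 1 = 0 → Module.finrank ℚ K = 2 →
      ∀ (P₀ : B.toAffine.Point), ¬ IsOfFinAddOrder (QuadraticDescent.incl K B P₀) →
        (∀ Q : B.toAffine.Point, ∃ m : ℤ,
          IsOfFinAddOrder (QuadraticDescent.incl K B Q - m • QuadraticDescent.incl K B P₀)) →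
      ∀ (Y : (B.baseChange K).toAffine.Point) (u : ℚ), u ≠ 0 → padicValRat 2 u = 0 →
        ((u * qB : ℚ) : ℝ) * canonicalHeight (QuadraticDescent.incl K B P₀) =
          (2 : ℝ) ^ (if p % 9 = 4 then (0 : ℤ) else -2) * canonicalHeight Y →
      ∃ j : ℕ, (∃ Y' T' : (B.baseChange K).toAffine.Point,
          IsOfFinAddOrder T' ∧ Y = ((2 : ℤ) ^ j) • Y' + T') ∧
        (padicValNat 2 (Nat.card (AddCommGroup.primaryComponent B.sha 2)) : ℤ) ≤
          2 * (j : ℤ) + (if p % 9 = 4 then (0 : ℤ) else -2))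
    (hFP : Theses.SylvesterTwoHeegnerIndex.PublishedFactsTwoPlus) {p : ℕ} (hp : p.Prime)
    (h9 : p % 9 = 4 ∨ p % 9 = 7) (h3 : ¬ ∃ x : ZMod p, x ^ 3 = 3) (B : WeierstrassCurve ℚ)
    [B.IsElliptic] [B.IsGloballyMinimal] (hB : ∃ C : VariableChange ℚ, C • B = cubeSumCurve (p : ℚ)) :
    MissingUpperBoundAt B 2 := by
  have hFP' := hFP
  obtain ⟨⟨hHSY, -⟩, -⟩ := hFP'
  obtain ⟨ω, hω⟩ := exists_omega_cyclotomicField_three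
  have h2K := finrank_cyclotomicField_three
  obtain ⟨qB, hqB, hq0, hrank, P, Y, u, hu0, hu, hP, hgen, hid⟩ :=
    hY p hp h9 B hB (CyclotomicField 3 ℚ) ω hω h2K
  have hp2 : p ≠ 2 := SylvesterTwoLower.ne_two_of_mod_nine h9
  refine (missingUpperBoundAt_two_iff_exists_powDivisible_ge hω h2K hp hp2 B hB hqB hq0 hrank P hP hgen
    Y hu0 hu (SylvesterTwoYin.even_displayExponent p) hid).mpr ?_
  obtain ⟨j, hdiv, hle⟩ := hup hFP p hp h9 h3 B hB qB hqB (CyclotomicField 3 ℚ) ω hω h2K P hP hgen Y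
    u hu0 hu hid
  refine ⟨j, hdiv, ?_⟩
  rwa [padicValNat_shaOrder_eq_primaryComponent hHSY hp h9 h3 B hB]

/-- **19725 `HeegnerIndexUpperAtTwoHSYOfFactsPlus` BY NAME ⟸ Yin's display + (up)** (p418375's content
disclosure `SylvesterTwoUpper.heegnerIndexUpperAtTwoHSY_iff_missingUpperBoundAt` under the antecedent).
A REDUCTION; (up) is open. [cite: Miller2011LMS, §1 and Def. 1.1] [cite: Kolyvagin1990, Thm. A] -/
theorem upperOfFactsPlus_of_yin_of_up (hY : SylvesterTwoYin.YinHeightDisplay)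
    (hup : Theses.SylvesterTwoHeegnerIndex.PublishedFactsTwoPlus →
      ∀ (p : ℕ), p.Prime → (p % 9 = 4 ∨ p % 9 = 7) → (¬ ∃ x : ZMod p, x ^ 3 = 3) →
      ∀ (B : WeierstrassCurve ℚ) [B.IsElliptic] [B.IsGloballyMinimal],
        (∃ C : VariableChange ℚ, C • B = cubeSumCurve (p : ℚ)) → ∀ (qB : ℚ), shaAn B = (qB : ℂ) →
      ∀ (K : Type) [Field K] [NumberField K] (ω : K), ω ^ 2 + ω + 1 = 0 → Module.finrank ℚ K = 2 →
      ∀ (P₀ : B.toAffine.Point), ¬ IsOfFinAddOrder (QuadraticDescent.incl K B P₀) →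
        (∀ Q : B.toAffine.Point, ∃ m : ℤ,
          IsOfFinAddOrder (QuadraticDescent.incl K B Q - m • QuadraticDescent.incl K B P₀)) →
      ∀ (Y : (B.baseChange K).toAffine.Point) (u : ℚ), u ≠ 0 → padicValRat 2 u = 0 →
        ((u * qB : ℚ) : ℝ) * canonicalHeight (QuadraticDescent.incl K B P₀) =
          (2 : ℝ) ^ (if p % 9 = 4 then (0 : ℤ) else -2) * canonicalHeight Y →
      ∃ j : ℕ, (∃ Y' T' : (B.baseChange K).toAffine.Point,
          IsOfFinAddOrder T' ∧ Y = ((2 : ℤ) ^ j) • Y' + T') ∧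
        (padicValNat 2 (Nat.card (AddCommGroup.primaryComponent B.sha 2)) : ℤ) ≤
          2 * (j : ℤ) + (if p % 9 = 4 then (0 : ℤ) else -2)) :
    Theses.SylvesterTwoHeegnerIndex.HeegnerIndexUpperAtTwoHSYOfFactsPlus := by
  intro hFP
  exact (SylvesterTwoUpper.heegnerIndexUpperAtTwoHSY_iff_missingUpperBoundAt hFP.1).mpr
    fun p hp h9 h3 B _ _ hB => forall_missingUpperBoundAt_of_yin_of_up hY hup hFP hp h9 h3 B hB

/-- **The LIVE child 19804 `UpperOffV0HSYPlus` BY NAME ⟸ Yin's display + (up)** (its off-`𝒱₀`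
condition and the twin are idle: (up) gives every member). A REDUCTION; (up) is open — for the member
rows with `Ш(E_p)[2] ≠ 0` it is the DEAD line offv0-kolyvagin2's residual (OFFB) in point currency.
[cite: Miller2011LMS, §1 and Def. 1.1] [cite: Kolyvagin1990, Thm. A] -/
theorem upperOffV0HSYPlus_of_yin_of_up (hY : SylvesterTwoYin.YinHeightDisplay)
    (hup : Theses.SylvesterTwoHeegnerIndex.PublishedFactsTwoPlus →
      ∀ (p : ℕ), p.Prime → (p % 9 = 4 ∨ p % 9 = 7) → (¬ ∃ x : ZMod p, x ^ 3 = 3) →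
      ∀ (B : WeierstrassCurve ℚ) [B.IsElliptic] [B.IsGloballyMinimal],
        (∃ C : VariableChange ℚ, C • B = cubeSumCurve (p : ℚ)) → ∀ (qB : ℚ), shaAn B = (qB : ℂ) →
      ∀ (K : Type) [Field K] [NumberField K] (ω : K), ω ^ 2 + ω + 1 = 0 → Module.finrank ℚ K = 2 →
      ∀ (P₀ : B.toAffine.Point), ¬ IsOfFinAddOrder (QuadraticDescent.incl K B P₀) →
        (∀ Q : B.toAffine.Point, ∃ m : ℤ,
          IsOfFinAddOrder (QuadraticDescent.incl K B Q - m • QuadraticDescent.incl K B P₀)) →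
      ∀ (Y : (B.baseChange K).toAffine.Point) (u : ℚ), u ≠ 0 → padicValRat 2 u = 0 →
        ((u * qB : ℚ) : ℝ) * canonicalHeight (QuadraticDescent.incl K B P₀) =
          (2 : ℝ) ^ (if p % 9 = 4 then (0 : ℤ) else -2) * canonicalHeight Y →
      ∃ j : ℕ, (∃ Y' T' : (B.baseChange K).toAffine.Point,
          IsOfFinAddOrder T' ∧ Y = ((2 : ℤ) ^ j) • Y' + T') ∧
        (padicValNat 2 (Nat.card (AddCommGroup.primaryComponent B.sha 2)) : ℤ) ≤
          2 * (j : ℤ) + (if p % 9 = 4 then (0 : ℤ) else -2)) :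
    Theses.SylvesterTwoHeegnerIndex.UpperOffV0HSYPlus := by
  intro hFP p hp h9 h3 A B _ _ _ _ hB _ _
  exact forall_missingUpperBoundAt_of_yin_of_up hY hup hFP hp h9 h3 B hB

/-- **The LIVE child 19802 `HSYPointTwoDivisibleSevenModNine` (THEOREM C) BY NAME ⟸ Yin's display +
(up) + `PublishedFactsTwoPlus`.** (up) gives `MissingUpperBoundAt B 2`, hence `0 ≤ ord₂ #Ш_an(E_p)`;
the twin has `ord₂ #Ш_an(E_{3p²}) = ord₂ #Ш(E_{3p²})[2^∞] ≥ 0` (`SylvesterTwoUpper.pair_shaAn_two`: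
Hu–Shu–Yin rank `0` + Burungale–Flach + modularity), so the PAIR product is `2`-integral on
`p ≡ 7 (9)`, which IS THEOREM C modulo Hu–Shu–Yin's display (bsd-cm-two's
`hsyPointTwoDivisibleSevenModNine_of_heightDisplay_of_twoIntegral`, p464849). A REDUCTION.
[cite: HuShuYin2019, Thm. 1.4 and display (bsd) p. 12] [cite: BurungaleFlach2024, Thm. 1.1 and Cor. 2]
[cite: Miller2011LMS, Def. 1.1] -/
theorem hsyPointTwoDivisibleSevenModNine_of_yin_of_up (hY : SylvesterTwoYin.YinHeightDisplay)
    (hup : Theses.SylvesterTwoHeegnerIndex.PublishedFactsTwoPlus →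
      ∀ (p : ℕ), p.Prime → (p % 9 = 4 ∨ p % 9 = 7) → (¬ ∃ x : ZMod p, x ^ 3 = 3) →
      ∀ (B : WeierstrassCurve ℚ) [B.IsElliptic] [B.IsGloballyMinimal],
        (∃ C : VariableChange ℚ, C • B = cubeSumCurve (p : ℚ)) → ∀ (qB : ℚ), shaAn B = (qB : ℂ) →
      ∀ (K : Type) [Field K] [NumberField K] (ω : K), ω ^ 2 + ω + 1 = 0 → Module.finrank ℚ K = 2 →
      ∀ (P₀ : B.toAffine.Point), ¬ IsOfFinAddOrder (QuadraticDescent.incl K B P₀) →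
        (∀ Q : B.toAffine.Point, ∃ m : ℤ,
          IsOfFinAddOrder (QuadraticDescent.incl K B Q - m • QuadraticDescent.incl K B P₀)) →
      ∀ (Y : (B.baseChange K).toAffine.Point) (u : ℚ), u ≠ 0 → padicValRat 2 u = 0 →
        ((u * qB : ℚ) : ℝ) * canonicalHeight (QuadraticDescent.incl K B P₀) =
          (2 : ℝ) ^ (if p % 9 = 4 then (0 : ℤ) else -2) * canonicalHeight Y →
      ∃ j : ℕ, (∃ Y' T' : (B.baseChange K).toAffine.Point,
          IsOfFinAddOrder T' ∧ Y = ((2 : ℤ) ^ j) • Y' + T') ∧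
        (padicValNat 2 (Nat.card (AddCommGroup.primaryComponent B.sha 2)) : ℤ) ≤
          2 * (j : ℤ) + (if p % 9 = 4 then (0 : ℤ) else -2))
    (hFP : Theses.SylvesterTwoHeegnerIndex.PublishedFactsTwoPlus) :
    Theses.SylvesterTwoHeegnerIndex.HSYPointTwoDivisibleSevenModNine := by
  have hFP' := hFP
  obtain ⟨⟨hHSY, hCM0, hmod, -⟩, hH⟩ := hFP'
  refine hsyPointTwoDivisibleSevenModNine_of_heightDisplay_of_twoIntegral hH ?_
  intro p hp h7 h3 A B _ _ _ _ hB hA qB qA hqB hqA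
  obtain ⟨-, -, qB', qA', hqB', hqA', hqB0, hqA0, hvA⟩ :=
    SylvesterTwoUpper.pair_shaAn_two hHSY hCM0 hmod hp (Or.inr h7) h3 A B hB hA
  have eB : qB' = qB := by exact_mod_cast hqB'.symm.trans hqB
  have eA : qA' = qA := by exact_mod_cast hqA'.symm.trans hqA
  subst eB eA
  obtain ⟨q, hq, hle⟩ := forall_missingUpperBoundAt_of_yin_of_up hY hup hFP hp (Or.inr h7) h3 B hB
  have e : q = qB' := by exact_mod_cast hq.symm.trans hqB
  subst e
  have hB0 : 0 ≤ padicValRat 2 q := le_trans (by exact_mod_cast Nat.zero_le _) hle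
  have hA0 : 0 ≤ padicValRat 2 qA' := by rw [hvA]; exact_mod_cast Nat.zero_le _
  rw [padicValRat.mul hqB0 hqA0]
  linarith

/-- **CONVERSELY (losslessness): 19725 + Yin's display ⟹ (up).** If the UPPER crux holds then, granted
`PublishedFactsTwoPlus` and the display, at every display datum of every member some power `2^j`
divides `Y` modulo torsion with `ord₂ #Ш(B)[2^∞] ≤ 2j + 2δ`
(`missingUpperBoundAt_two_iff_exists_powDivisible_ge`, `.mp`). So (up) is EXACTLY the UPPER crux
modulo the display. [cite: Miller2011LMS, §1 and Def. 1.1] [cite: HuShuYin2019, Thm. 1.3 / 1.4, pp. 8, 12] -/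
theorem up_of_upperOfFactsPlus_of_yin
    (hupP : Theses.SylvesterTwoHeegnerIndex.HeegnerIndexUpperAtTwoHSYOfFactsPlus)
    (hY : SylvesterTwoYin.YinHeightDisplay) :
    Theses.SylvesterTwoHeegnerIndex.PublishedFactsTwoPlus →
      ∀ (p : ℕ), p.Prime → (p % 9 = 4 ∨ p % 9 = 7) → (¬ ∃ x : ZMod p, x ^ 3 = 3) →
      ∀ (B : WeierstrassCurve ℚ) [B.IsElliptic] [B.IsGloballyMinimal],
        (∃ C : VariableChange ℚ, C • B = cubeSumCurve (p : ℚ)) → ∀ (qB : ℚ), shaAn B = (qB : ℂ) →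
      ∀ (K : Type) [Field K] [NumberField K] (ω : K), ω ^ 2 + ω + 1 = 0 → Module.finrank ℚ K = 2 →
      ∀ (P₀ : B.toAffine.Point), ¬ IsOfFinAddOrder (QuadraticDescent.incl K B P₀) →
        (∀ Q : B.toAffine.Point, ∃ m : ℤ,
          IsOfFinAddOrder (QuadraticDescent.incl K B Q - m • QuadraticDescent.incl K B P₀)) →
      ∀ (Y : (B.baseChange K).toAffine.Point) (u : ℚ), u ≠ 0 → padicValRat 2 u = 0 →
        ((u * qB : ℚ) : ℝ) * canonicalHeight (QuadraticDescent.incl K B P₀) =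
          (2 : ℝ) ^ (if p % 9 = 4 then (0 : ℤ) else -2) * canonicalHeight Y →
      ∃ j : ℕ, (∃ Y' T' : (B.baseChange K).toAffine.Point,
          IsOfFinAddOrder T' ∧ Y = ((2 : ℤ) ^ j) • Y' + T') ∧
        (padicValNat 2 (Nat.card (AddCommGroup.primaryComponent B.sha 2)) : ℤ) ≤
          2 * (j : ℤ) + (if p % 9 = 4 then (0 : ℤ) else -2) := by
  intro hFP p hp h9 h3 B _ _ hB qB hqB K _ _ ω hω h2K P₀ hP hgen Y u hu0 hu hid
  have hFP' := hFP
  obtain ⟨⟨hHSY, -⟩, -⟩ := hFP'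
  have hM : MissingUpperBoundAt B 2 :=
    (SylvesterTwoUpper.heegnerIndexUpperAtTwoHSY_iff_missingUpperBoundAt hFP.1).mp (hupP hFP) p hp h9
      h3 B hB
  obtain ⟨qB', hqB', hq0', hrank, -⟩ := hY p hp h9 B hB K ω hω h2K
  have e : qB' = qB := by exact_mod_cast hqB'.symm.trans hqB
  subst e
  have hp2 : p ≠ 2 := SylvesterTwoLower.ne_two_of_mod_nine h9
  obtain ⟨j, hdiv, hle⟩ := (missingUpperBoundAt_two_iff_exists_powDivisible_ge hω h2K hp hp2 B hB hqB
    hq0' hrank P₀ hP hgen Y hu0 hu (SylvesterTwoYin.even_displayExponent p) hid).mp hM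
  refine ⟨j, hdiv, ?_⟩
  rwa [padicValNat_shaOrder_eq_primaryComponent hHSY hp h9 h3 B hB] at hle

/-- **THE UPPER CRUX OF K7t IS (up), modulo Yin's display** —
`HeegnerIndexUpperAtTwoHSYOfFactsPlus ↔ (up)` granted `YinHeightDisplay`. Nothing asserted about either
side. [cite: Miller2011LMS, §1 and Def. 1.1] [cite: Kolyvagin1990, Thm. A] -/
theorem upperOfFactsPlus_iff_up_of_yin (hY : SylvesterTwoYin.YinHeightDisplay) :
    Theses.SylvesterTwoHeegnerIndex.HeegnerIndexUpperAtTwoHSYOfFactsPlus ↔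
      (Theses.SylvesterTwoHeegnerIndex.PublishedFactsTwoPlus →
      ∀ (p : ℕ), p.Prime → (p % 9 = 4 ∨ p % 9 = 7) → (¬ ∃ x : ZMod p, x ^ 3 = 3) →
      ∀ (B : WeierstrassCurve ℚ) [B.IsElliptic] [B.IsGloballyMinimal],
        (∃ C : VariableChange ℚ, C • B = cubeSumCurve (p : ℚ)) → ∀ (qB : ℚ), shaAn B = (qB : ℂ) →
      ∀ (K : Type) [Field K] [NumberField K] (ω : K), ω ^ 2 + ω + 1 = 0 → Module.finrank ℚ K = 2 →
      ∀ (P₀ : B.toAffine.Point), ¬ IsOfFinAddOrder (QuadraticDescent.incl K B P₀) →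
        (∀ Q : B.toAffine.Point, ∃ m : ℤ,
          IsOfFinAddOrder (QuadraticDescent.incl K B Q - m • QuadraticDescent.incl K B P₀)) →
      ∀ (Y : (B.baseChange K).toAffine.Point) (u : ℚ), u ≠ 0 → padicValRat 2 u = 0 →
        ((u * qB : ℚ) : ℝ) * canonicalHeight (QuadraticDescent.incl K B P₀) =
          (2 : ℝ) ^ (if p % 9 = 4 then (0 : ℤ) else -2) * canonicalHeight Y →
      ∃ j : ℕ, (∃ Y' T' : (B.baseChange K).toAffine.Point,
          IsOfFinAddOrder T' ∧ Y = ((2 : ℤ) ^ j) • Y' + T') ∧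
        (padicValNat 2 (Nat.card (AddCommGroup.primaryComponent B.sha 2)) : ℤ) ≤
          2 * (j : ℤ) + (if p % 9 = 4 then (0 : ℤ) else -2)) :=
  ⟨fun hupP => up_of_upperOfFactsPlus_of_yin hupP hY, fun hup => upperOfFactsPlus_of_yin_of_up hY hup⟩

/-! ## §3 RUNG: the leaf `X12.CMAtTwo` ⟺ (low) ∧ (up), modulo print + Yin's display -/

/-- **BSD₂ ON THE SYLVESTER FAMILY ⟺ EXACT `2`-DIVISIBILITY INDEX OF ONE POINT PER `p`.** Granted the
route's support conjunction `PublishedFactsTwoPlus` (19724: Hu–Shu–Yin, Burungale–Flach / Rubin,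
modularity, LLT/Kobayashi bookkeeping, Gross–Zagier / Kolyvagin schemata, GZK, Waldspurger, parity,
Heegner points, HSY's display — all PRINT, hypotheses) and Yin's display (PREPRINT): the rung leaf K7t
`X12.CMAtTwo` (`BSD(E_p, 2)` for every minimal model of every `E_p` in 𝒞_HSY) holds IFF (low) ∧ (up).
`←`: the route's deciding theorem `Theses.SylvesterTwoHeegnerIndex.closes` on §1 and §2. `→`: the leaf
gives the LOWER crux back (`SylvesterTwoLower.heegnerIndexLowerAtTwoHSY_of_cmAtTwo`) and, per member,
`BSDp B 2 ⟹ MissingUpperBoundAt B 2` (`Typed.missingPPartAt_of_bsdp`), then §1/§2's converses.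
HONEST READING: an EQUIVALENT REFORMULATION of the open leaf — the unknown of 𝒞_HSY at `2` is, per `p`,
ONE integer (the index of Yin's `Z_p` in `E_p(ℚ(√−3))/tors ≅ ℤ[ω]`), and BSD₂ says it equals
`ord₂ #Ш(E_p)[2^∞]/2 − δ`; nothing here decides it for any `p`.
[cite: Miller2011LMS, §1 and Def. 1.1] [cite: HuShuYin2019, Thm. 1.3 / 1.4 and display (bsd) p. 12]
[cite: BurungaleFlach2024, Thm. 1.1 and Cor. 2] -/
theorem cmAtTwo_iff_low_and_up_of_yin (hFP : Theses.SylvesterTwoHeegnerIndex.PublishedFactsTwoPlus)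
    (hY : SylvesterTwoYin.YinHeightDisplay) :
    _root_.Summit.BirchSwinnertonDyer.Rank1Residual.X12.CMAtTwo ↔
      ((Theses.SylvesterTwoHeegnerIndex.PublishedFactsTwo →
      ∀ (p : ℕ), p.Prime → (p % 9 = 4 ∨ p % 9 = 7) → (¬ ∃ x : ZMod p, x ^ 3 = 3) →
      ∀ (B : WeierstrassCurve ℚ) [B.IsElliptic] [B.IsGloballyMinimal],
        (∃ C : VariableChange ℚ, C • B = cubeSumCurve (p : ℚ)) → ∀ (qB : ℚ), shaAn B = (qB : ℂ) →
      ∀ (K : Type) [Field K] [NumberField K] (ω : K), ω ^ 2 + ω + 1 = 0 → Module.finrank ℚ K = 2 →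
      ∀ (P₀ : B.toAffine.Point), ¬ IsOfFinAddOrder (QuadraticDescent.incl K B P₀) →
        (∀ Q : B.toAffine.Point, ∃ m : ℤ,
          IsOfFinAddOrder (QuadraticDescent.incl K B Q - m • QuadraticDescent.incl K B P₀)) →
      ∀ (Y : (B.baseChange K).toAffine.Point) (u : ℚ), u ≠ 0 → padicValRat 2 u = 0 →
        ((u * qB : ℚ) : ℝ) * canonicalHeight (QuadraticDescent.incl K B P₀) =
          (2 : ℝ) ^ (if p % 9 = 4 then (0 : ℤ) else -2) * canonicalHeight Y →
      ∀ j : ℕ, (∃ Y' T' : (B.baseChange K).toAffine.Point,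
          IsOfFinAddOrder T' ∧ Y = ((2 : ℤ) ^ j) • Y' + T') →
        2 * (j : ℤ) + (if p % 9 = 4 then (0 : ℤ) else -2) ≤
          (padicValNat 2 (Nat.card (AddCommGroup.primaryComponent B.sha 2)) : ℤ)) ∧
      (Theses.SylvesterTwoHeegnerIndex.PublishedFactsTwoPlus →
      ∀ (p : ℕ), p.Prime → (p % 9 = 4 ∨ p % 9 = 7) → (¬ ∃ x : ZMod p, x ^ 3 = 3) →
      ∀ (B : WeierstrassCurve ℚ) [B.IsElliptic] [B.IsGloballyMinimal],
        (∃ C : VariableChange ℚ, C • B = cubeSumCurve (p : ℚ)) → ∀ (qB : ℚ), shaAn B = (qB : ℂ) →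
      ∀ (K : Type) [Field K] [NumberField K] (ω : K), ω ^ 2 + ω + 1 = 0 → Module.finrank ℚ K = 2 →
      ∀ (P₀ : B.toAffine.Point), ¬ IsOfFinAddOrder (QuadraticDescent.incl K B P₀) →
        (∀ Q : B.toAffine.Point, ∃ m : ℤ,
          IsOfFinAddOrder (QuadraticDescent.incl K B Q - m • QuadraticDescent.incl K B P₀)) →
      ∀ (Y : (B.baseChange K).toAffine.Point) (u : ℚ), u ≠ 0 → padicValRat 2 u = 0 →
        ((u * qB : ℚ) : ℝ) * canonicalHeight (QuadraticDescent.incl K B P₀) =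
          (2 : ℝ) ^ (if p % 9 = 4 then (0 : ℤ) else -2) * canonicalHeight Y →
      ∃ j : ℕ, (∃ Y' T' : (B.baseChange K).toAffine.Point,
          IsOfFinAddOrder T' ∧ Y = ((2 : ℤ) ^ j) • Y' + T') ∧
        (padicValNat 2 (Nat.card (AddCommGroup.primaryComponent B.sha 2)) : ℤ) ≤
          2 * (j : ℤ) + (if p % 9 = 4 then (0 : ℤ) else -2))) := by
  constructor
  · intro hleaf
    have hFP' := hFP
    obtain ⟨hF, -⟩ := hFP'
    have hF' := hF
    obtain ⟨hHSY, -⟩ := hF'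
    refine ⟨low_of_lowerOfFacts_of_yin (fun _ => SylvesterTwoLower.heegnerIndexLowerAtTwoHSY_of_cmAtTwo
      hF hleaf) hY, up_of_upperOfFactsPlus_of_yin ?_ hY⟩
    intro hFP''
    refine (SylvesterTwoUpper.heegnerIndexUpperAtTwoHSY_iff_missingUpperBoundAt hFP''.1).mpr
      fun p hp h9 h3 B _ _ hB => ?_
    haveI : Fact (2 : ℕ).Prime := ⟨Nat.prime_two⟩
    obtain ⟨A, _, _, CA, hCA⟩ := SylvesterTwoLowerSplit.exists_partner hp
    obtain ⟨-, -, hfinB, -⟩ := hHSY p hp h9 h3 A B hB ⟨CA, hCA⟩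
    haveI : Finite B.sha := hfinB
    exact (lower_and_upper_of_missingPPartAt B 2 (missingPPartAt_of_bsdp B 2 (hleaf p hp h9 h3 B hB))).2
  · rintro ⟨hlow, hup⟩
    exact Theses.SylvesterTwoHeegnerIndex.closes (lowerOfFacts_of_yin_of_low hY hlow)
      (upperOfFactsPlus_of_yin_of_up hY hup) hFP

end Summit.BirchSwinnertonDyer.BirchSwinnertonDyer.Theorems.SylvesterTwoYinLower

end
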